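import Summits.QuantumFields.YangMills.Theorems.BalabanUVNodesN18AtTermDatumInputs226
import Summits.QuantumFields.YangMills.Theorems.BalabanUVNodesN18AtReadingOfRecord13CoP

/-!
# BalabanUVNodes ∕ node N18 = NE5 — THE KEYED ROWS AT THE STAGE-13 `CoP` HOMES FOR THE RUN TOWERS GENERATED BY W1's (2.14) TERM DATA (`(𝔇 F θ k).Gn₀`),
# THE CONFIGURATION DIRECTION = NODE A's LOCATED INPUTS PER TERM (dag-n18-c's θ-level junction `…N18AtTermDatumInputs226`, p525011, lifted to the record)
# (Track A, DAG node N18 = `T4OutputRate.NE5` :211; cluster K4 «SpineRates», item K3⁵ `SpineGivenEndpointR13SepCoP` = stmt-QuantumFields-20296; module 18i of seat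
# pub-ymgap-dag-n18-d, strategy s2 «knit at the record»; RECORD 13 v1.5 `CoP` edition — director-ym №160; binder `Provisos₁₃Core`, key `IsDatumOfRecord₁₃CCoP`)

HONEST FRAMING.  Count-neutral kernel bookkeeping (`--supports … --as helper`): two ∀-introductions over a landed θ-level theorem; NE5 is NOT PRINTED ([I] Thm 1
p. 259 prints the ACTION's rate) and NOT proved; N18 is NOT discharged; no inhabitant of `IsDatumOfRecord₁₃CCoP` ∕ `Provisos₁₃Core` is claimed (K0 OPEN); THE END's
data, NODE A's located input records and every numeral are HYPOTHESES; the term data `𝔇`, the estimate records `c`, the tables `sp ⊆ big`, gauge ∕ transport ∕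
letters are PARAMETERS.

WHY.  dag-n18-c's file 33 (`…N18AtTermDatumInputs226`, p525011) is the most located junction of node N18 in the tree: at ONE Stage-13 tuple `θ` and ONE run length
`k`, for the run towers generated by a (2.14) term-datum family through W1-9's total generator `runTowers (k ↦ toClusterTower (𝔇 k).Gn₀)`, (i) THE END's data with
the NODE-A majorant as hypothesis + (ii)′ NODE A's located inputs per term (W1 STOREY 8 `Inputs226Holo`, n18-c file 32's `hloc`) + numerals ⟹ `N18At` at node
U3's Stage-13 bundle — it is this seat's module 18g §2 with the abstract schema (GEN) REPLACED by the located records (n18-c file 32 `stepGen_Gn_of_inputs226Holo`).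
Its author left «the family rows at the keyed homes» to the record side (this seat's row s2: every N18 junction has its rows at `S_N18 (RRec₁₃… 𝔯)`, index HOME
`N18-S2-INDEX.md`).  THIS FILE supplies them at the live (`CoP`) key, VERBATIM the pattern of module 18gᶜᵒᵖ §3 (p527880): the per-tuple hypothesis of p525011
asked at EVERY admissible Stage-13 tuple with `Provisos₁₃Core` (resp. only IN a regime `Rg`) and every run length, for a reading `𝔯` PINNED to the term-data
reading family; the instance `NeZero θ.τ9.M` the θ-level theorem carries (print's term set `terms L M Z` is typed for a positive cube size; W1's positive-cube-size
generator `Gn` is identified with the total `Gn₀` there, W1-9 `TermData214.Gn₀_eq`) is DISCHARGED per tuple from admissibility — Stage 9's clause `1 ≤ τ9.M`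
(`Stage13Params.Admissible.toStage9`, `Node00/Record9` `Stage9Params.Admissible` :117; [III] p. 245 «M = L^m») — so the rows ask EXACTLY p525011's package, under `∀ [NeZero θ.τ9.M]`.

WHAT (all `theorem`, 0 `def`; ns `YMDAG.N18.W1Reading`).
* ★ `s_N18_rRec₁₃CoP_readingAdm_runTowers_Gn₀_of_inputs226Holo_pin` — `S_N18 (RRec₁₃CoP 𝔯)` for `𝔯` pinned (`hpin`) to
  `fun F θ => ReadingData.ofRecordAdm F θ.τ9.M N (runTowers (k ↦ toClusterTower (𝔇 F θ k).Gn₀)) (sp F θ) (gauge F θ) (hg F θ) (T₀ F θ) (hT F θ) (li F θ)`, from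
  `h : ∀ F θ, Provisos₁₃Core → Admissible → ∀ [NeZero θ.τ9.M] k, ⟨p525011's package at (F, θ, k) in family form⟩` (module 18ᶜᵒᵖ `s_N18_rRec₁₃CoP_of_forall_admissible_pin` ∘
  p525011, the instance from `Admissible.toStage9`).
* ★ `s_N18_rRec₁₃CoPOn_readingAdm_runTowers_Gn₀_of_inputs226Holo_pin` — the same asked only at the tuples IN `Rg` ⟹ `S_N18 (RRec₁₃CoPOn 𝔯 Rg)` (layer B
  `s_N18_rRec₁₃CoPOn_iff`; rev 16∕17's guarded binder at `Rg F θ := θ.ZtUnity F N ∧ θ.SlotsNondegenerate₁₃ F N`).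
Families over `(F, θ)`: estimate records `c F θ : ℕ → B13.Consts` (one per torus; `c₀` the data's), block sizes `L F θ : ℕ → ℕ` (`[NeZero]`), term data
`𝔇 F θ k : W1.TermData214 (c₀ F θ k) (F.P k) (MatA N) θ.τ9.M (L F θ k)`, coupling domains `D F θ`, tables `sp F θ ⊆ big F θ`, gauge ∕ transport ∕ clause ∕ letters.

One finite four-torus programme at fixed `ε`; NOT the continuum limit, NOT OS, NOT a mass gap, NOT Clay.  0 `def`, 0 `sorry`.  Sources (TYPES ∕ loci only):
T. Bałaban, CMP **109** (1987) [Balaban1987RG1] (0.23)–(0.25) pp. 256–257, Thm 1 p. 259, (1.18) p. 263; CMP **116** (1988) [Balaban1988RG2Cluster] (2.13)–(2.14) pp. 14–15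
and the analyticity statement p. 15, (2.16)–(2.26) pp. 16–17, Lemma 3 (2.38) p. 20; CMP **119** (1988) [Balaban1988Convergent] p. 245; CMP **122** (1989)
[Balaban1989LargeFieldII] (the record's stage).
-/

noncomputable section

open Set Metric
open scoped BigOperators Matrix Matrix.Norms.L2Operator

namespace YMDAG.N18.W1Reading

open Literature.MathematicalPhysics.QuantumFieldTheory.Balaban1983to89
open Literature.MathematicalPhysics.QuantumFieldTheory.Balaban1983to89.T4Continuum
open Literature.MathematicalPhysics.QuantumFieldTheory.Balaban1983to89.T4OutputRate (Carriers Functional NE5 DecayBound Window)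
open Literature.MathematicalPhysics.QuantumFieldTheory.Balaban1983to89.T4InputCauchyRateData (StepModel)
open Literature.MathematicalPhysics.QuantumFieldTheory.Balaban1983to89.B13Resummation (locE)
open Literature.MathematicalPhysics.QuantumFieldTheory.Balaban1983to89.TreeLengthTorus (TDom TPt tsys torusTreeLen)
open Literature.MathematicalPhysics.QuantumFieldTheory.Balaban1983to89.TreeLengthTorusGeometry (TTouch)
open Literature.MathematicalPhysics.QuantumFieldTheory.Balaban1983to89.B12TreeDecay (K₀)
open Literature.MathematicalPhysics.QuantumFieldTheory.Balaban1983to89.B13Lemma3TorusTerms (terms)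
open Literature.MathematicalPhysics.QuantumFieldTheory.Balaban1983to89.B9Thm37GlueTorus (tdist1)
open Literature.MathematicalPhysics.QuantumFieldTheory.Balaban1983to89.B13Lemma3TorusSocket (Lemma3Numerics)
open Literature.MathematicalPhysics.QuantumFieldTheory.Balaban1983to89.Node00 (Stage12Params Stage13Params U3Letters₁₁ U3Objects₁₁ NE2Objects₁₁ NE3Letters₁₁
  prependCoupling MatA ιSU)
open Literature.MathematicalPhysics.QuantumFieldTheory.Balaban1983to89.Node00.Sect2 (domCount domSys CPair ofBackgroundC)
open Literature.MathematicalPhysics.QuantumFieldTheory.Balaban1983to89.Node00.W1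
open Summit.QuantumFields.BalabanUV.T4Continuum.Spine.NE5
open Summit.QuantumFields.YangMills.BalabanUVNodes.N18AtTermDatumInputs226 (n18At_u3OfRecord₁₃_readingAdm_runTowers_Gn₀_of_inputs226Holo)
open YMDAG.N18.HLayer
open YMDAG.UVSplit

variable {N : ℕ} [NeZero N]

/-! ## §1 The family rows at the Stage-13 `CoP` homes for the run towers generated by the term data, configuration direction = NODE A's located inputs -/

section Record

variable (𝔯 : RateReading₁₃CoP N) (Rg : (F : T4Family) → Stage13Params F N → Prop)
  {c₀ : (F : T4Family) → Stage13Params F N → ℕ → B13.Consts} (c : (F : T4Family) → Stage13Params F N → ℕ → B13.Consts)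
  (L : (F : T4Family) → Stage13Params F N → ℕ → ℕ) [hL : ∀ (F : T4Family) (θ : Stage13Params F N) (k : ℕ), NeZero (L F θ k)]
  (𝔇 : (F : T4Family) → (θ : Stage13Params F N) → (k : ℕ) → TermData214 (c₀ F θ k) (F.P k) (MatA N) θ.τ9.M (L F θ k))
  (D : (F : T4Family) → Stage13Params F N → Set ℂ)
  (sp big : (F : T4Family) → (θ : Stage13Params F N) → (k j : ℕ) → (domSys (F.P k) θ.τ9.M j).Dom → Set (CPair (F.P k) (MatA N)))
  (gauge : (F : T4Family) → (θ : Stage13Params F N) → (k : ℕ) → GaugeField (F.P k) 0 (Node00.SU N) → GaugeField (F.P k) 0 (Node00.SU N) → ℝ)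
  (hg : ∀ (F : T4Family) (θ : Stage13Params F N) (k : ℕ) (U U' : GaugeField (F.P k) 0 (Node00.SU N)), 0 ≤ gauge F θ k U U')
  (T₀ : (F : T4Family) → (θ : Stage13Params F N) → (k : ℕ) → GaugeField (F.P (k + 1)) 0 (Node00.SU N) → GaugeField (F.P k) 0 (Node00.SU N))
  (hT : ∀ (F : T4Family) (θ : Stage13Params F N) (k : ℕ) (U : GaugeField (F.P (k + 1)) 0 (Node00.SU N)),
    (∀ (j : ℕ) (Y : (domSys (F.P (k + 1)) θ.τ9.M j).Dom), ofBackgroundC (ιSU N) U ∈ sp F θ (k + 1) j Y) →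
      ∀ (j : ℕ) (X : (domSys (F.P k) θ.τ9.M j).Dom), ofBackgroundC (ιSU N) (T₀ F θ k U) ∈ sp F θ k j X)
  (li : (F : T4Family) → Stage13Params F N → LetterInputs)
  (hpin : ∀ (F : T4Family) (θ : Stage13Params F N) (hP : θ.Provisos₁₃Core F N) (g₀ : ℕ → ℝ) (os : List (ULoop F)),
    (𝔯.lit F θ hP g₀ os).u3 =
      (ReadingData.ofRecordAdm F θ.τ9.M N (runTowers fun k => toClusterTower (𝔇 F θ k).Gn₀) (sp F θ) (gauge F θ) (hg F θ) (T₀ F θ) (hT F θ) (li F θ)).u3Objects θ.γ)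

include hpin in
open Classical in
/-- ★ **THE TERM-DATA ROW AT THE STAGE-13 `CoP` HOME — N18 FROM THE END's DATA AND NODE A's LOCATED INPUTS, AT EVERY ADMISSIBLE TUPLE** [bookkeeping; dag-n18-c's
`n18At_u3OfRecord₁₃_readingAdm_runTowers_Gn₀_of_inputs226Holo` (p525011) at every admissible Stage-13 tuple with provisos and every run length, module 18ᶜᵒᵖ's
`s_N18_rRec₁₃CoP_of_forall_admissible_pin`]: for a reading pinned to the admissible reading family whose towers are the run towers GENERATED BY THE (2.14) TERM DATA
`runTowers (k ↦ toClusterTower (𝔇 F θ k).Gn₀)` (tables `sp F θ`, transports `T₀ F θ` with clause `hT`, letters `li F θ`): if at EVERY admissible Stage-13 tuple `θ` with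
`Provisos₁₃Core` (its cube size `θ.τ9.M ≥ 1` by Stage 9's admissibility — the instance binder of `h`) and every run length `k` there are (i) THE END's data over the carriers of the admissible level pairing
(functionals of the run towers; NODE-A majorant as hypothesis; L01–L03 ∕ L07 ∕ L08 ∕ L09* ∕ L10; numerals) and (ii)′ per torus `k`, `k+1`: restriction-closed tables
inside OPEN located-inputs tables `big F θ`, the [II] (2.26) numerals of the estimate record `c F θ ·`, ONE W1 STOREY-8 located-inputs record `Inputs226Holo` per
table point ∕ term under LEMMA 2's guard (n18-c file 32's `hloc`, VERBATIM), the dominations `0 ≤ C₃ε₁ ≤ A_A ∕ A_B`, `R_d ≤ (1−8δ)·½L·κ`, the strict [KP86] and renewal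
clauses, `]0, γ′] ⊆ D F θ`, and the letters dominating — then `S_N18 (RRec₁₃CoP 𝔯)`.
[cite: Balaban1988RG2Cluster, (2.13)–(2.14) pp.14–15 and the analyticity statement p.15, (2.16)–(2.26) pp.16–17, Lemma 3 (2.38) p.20; Balaban1987RG1, (0.23)–(0.25) pp.256–257, Thm 1 p.259, (1.18) p.263] -/
theorem s_N18_rRec₁₃CoP_readingAdm_runTowers_Gn₀_of_inputs226Holo_pin
    (h : ∀ (F : T4Family) (θ : Stage13Params F N), θ.Provisos₁₃Core F N → θ.Admissible F N → ∀ [NeZero θ.τ9.M] (k : ℕ),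
      ∃ (Op : Type) (_ : NormedAddCommGroup Op) (_ : NormedSpace ℂ Op) (Hist : Type) (_ : NormedAddCommGroup Hist) (_ : NormedSpace ℂ Hist)
        (Mb : ℝ → StepModel (LevelPairing.ofRecordAdm F θ.τ9.M N k (sp F θ) (gauge F θ k) (hg F θ k) (T₀ F θ k) (hT F θ k)).carriers Op Hist)
        (act : ℝ → (j : ℕ) → Op × Hist → TDom 4 (domCount (F.P k) θ.τ9.M j) → ℂ) (γ' C3 ε₁ Rd κ A_A A_B E_A E_B E₁ δ δ' θr θ' cH ω ρ₀ B : ℝ) (k₀ : ℕ)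
        (aA a₂A a₂A' a₅A AabsA aB a₂B a₂B' a₅B AabsB : ℝ),
        (∀ b : ℝ, 0 < b → b ≤ γ' → ∀ (X : Node00.W1.Dom (F.P k) θ.τ9.M) (z : Op × Hist),
          (Mb b).Out X.1 z.1 z.2 X =
            locE (TTouch (d := 4) (N := domCount (F.P k) θ.τ9.M X.1)) (fun Z : (tsys 4 (domCount (F.P k) θ.τ9.M X.1)).Dom => Z.1)
              (act b X.1 z) X.2.1) ∧
        0 ≤ C3 ∧ 0 ≤ ε₁ ∧ 0 ≤ κ ∧ κ + 2 * (64 * Real.log 162) + 2 ≤ Rd ∧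
        C3 * ε₁ * Real.exp (5 * κ + 1) * K₀ 64 8 * 9 * 64 ≤ 1 ∧
        (∀ b : ℝ, 0 < b → b ≤ γ' → ∀ j, ∀ g ∈ Window γ',
          ∀ (U : (LevelPairing.ofRecordAdm F θ.τ9.M N k (sp F θ) (gauge F θ k) (hg F θ k) (T₀ F θ k) (hT F θ k)).BgB) (q : Op × Hist), q ∈ (Mb b).Base j g U →
          ∃ V : Set (Op × Hist), IsOpen V ∧ (Mb b).box j q ⊆ V ∧
            (∀ Z : TDom 4 (domCount (F.P k) θ.τ9.M j), DifferentiableOn ℂ (fun z : Op × Hist => act b j z Z) V) ∧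
            (∀ z ∈ V, ∀ Z : TDom 4 (domCount (F.P k) θ.τ9.M j), ‖act b j z Z‖ ≤ C3 * ε₁ * Real.exp (-(Rd * torusTreeLen Z.1)))) ∧
        (∀ b : ℝ, 0 < b → b ≤ γ' → L01 (Mb b)
          ((LevelPairing.ofRecordAdm F θ.τ9.M N k (sp F θ) (gauge F θ k) (hg F θ k) (T₀ F θ k) (hT F θ k)).EA (runTowers (fun k => toClusterTower ((𝔇 F θ k).Gn₀)) k)) (Window γ')) ∧
        (∀ b : ℝ, 0 < b → b ≤ γ' → L02 (Mb b)
          ((LevelPairing.ofRecordAdm F θ.τ9.M N k (sp F θ) (gauge F θ k) (hg F θ k) (T₀ F θ k) (hT F θ k)).EB (runTowers (fun k => toClusterTower ((𝔇 F θ k).Gn₀)) (k + 1)) b) (Window γ')) ∧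
        (∀ b : ℝ, 0 < b → b ≤ γ' → L03 (Mb b)
          ((LevelPairing.ofRecordAdm F θ.τ9.M N k (sp F θ) (gauge F θ k) (hg F θ k) (T₀ F θ k) (hT F θ k)).EB (runTowers (fun k => toClusterTower ((𝔇 F θ k).Gn₀)) (k + 1)) b) (Window γ')) ∧
        (∀ b : ℝ, 0 < b → b ≤ γ' → L07 (Mb b) (Window γ') δ θr) ∧
        (∀ b : ℝ, 0 < b → b ≤ γ' → L08 (Mb b) (Window γ') κ (Real.exp 1 * 9 * 64 * K₀ 64 8 ^ 2 * A_B) δ' θr) ∧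
        (∀ b : ℝ, 0 < b → b ≤ γ' → L09aff (Mb b) (Window γ')) ∧ (∀ b : ℝ, 0 < b → b ≤ γ' → L09blind (Mb b) (Window γ')) ∧
        (∀ b : ℝ, 0 < b → b ≤ γ' → L09hom (Mb b) (Window γ')) ∧ (∀ b : ℝ, 0 < b → b ≤ γ' → L09unit (Mb b) (Window γ') κ E₁ cH ω) ∧
        0 < E₁ ∧ 0 ≤ δ + δ' ∧ 0 ≤ θr ∧ θr ≤ θ' ∧ θ' ≤ 1 ∧ 0 ≤ cH ∧ 0 < ω ∧ ρ₀ < 1 ∧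
        (δ + δ') * θr ^ k₀ +
            cH * (Real.exp 1 * 9 * 64 * K₀ 64 8 ^ 2 * A_A + Real.exp 1 * 9 * 64 * K₀ 64 8 ^ 2 * A_B) / (1 - ω) ≤ ρ₀ ∧
        0 ≤ B ∧ (∀ k < k₀, Real.exp 1 * 9 * 64 * K₀ 64 8 ^ 2 * A_A + Real.exp 1 * 9 * 64 * K₀ 64 8 ^ 2 * A_B ≤ B * θr ^ k) ∧
        Real.exp 1 * 9 * 64 * K₀ 64 8 ^ 2 * C3 * cH * ε₁ < (θ' - ω) * (1 - ρ₀) ∧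
        (∀ m, SpRestr (sp F θ k (m + 1))) ∧
        (∀ (m : ℕ) (Z : (domSys (F.P k) θ.τ9.M (m + 1)).Dom), IsOpen (big F θ k (m + 1) Z)) ∧
        (∀ (m : ℕ) (Z : (domSys (F.P k) θ.τ9.M (m + 1)).Dom), sp F θ k (m + 1) Z ⊆ big F θ k (m + 1) Z) ∧
        1 ≤ (c F θ k).κ₁ ∧ (c F θ k).α₆ ≠ 0 ∧ 8 ≤ (c F θ k).L ∧ (c F θ k).L = L F θ k ∧
        Lemma3Numerics (c F θ k) θ.τ9.M (((c F θ k).L : ℝ) / 2) aA a₂A a₂A' a₅A AabsA ∧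
        (∀ m : ℕ, ∀ s ∈ D F θ, ∀ old : OlderTerms (F.P k) (MatA N) θ.τ9.M m,
          (∀ (j : Fin (m + 1)) (Y : (domSys (F.P k) θ.τ9.M j).Dom), ∀ ψ ∈ sp F θ k j Y, ‖old j Y ψ‖ ≤ E_A * Real.exp (-(κ * (domSys (F.P k) θ.τ9.M j).dj Y))) →
          (∀ (j : Fin (m + 1)) (Y : (domSys (F.P k) θ.τ9.M j).Dom), AnalyticOnNhd ℂ (old j Y) (sp F θ k j Y)) →
          ∀ (Z : (domSys (F.P k) θ.τ9.M (m + 1)).Dom), ∀ t ∈ terms (L F θ k) θ.τ9.M Z, ∀ φ₁ ∈ big F θ k (m + 1) Z,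
            ∃ ι : (𝔇 F θ k m).Inputs226Holo (c F θ k) Z t s old φ₁ aA a₅A,
            (∀ φ ∈ big F θ k (m + 1) Z, ∀ i j, DifferentiableOn ℂ (fun σ => (𝔇 F θ k m).A Z t φ σ i j) {σ | ∀ j, σ j ∈ ι.Uσ}) ∧
            (∀ φ ∈ big F θ k (m + 1) Z, ∀ i j, DifferentiableOn ℂ (fun σ => ((𝔇 F θ k m).𝒦 Z t).G2 σ ((𝔇 F θ k m).uOf Z t φ) i j) {σ | ∀ j, σ j ∈ ι.Uσ}) ∧
            (∀ σ : TPt (F.P k).d (domCount (F.P k) θ.τ9.M (m + 1)) → ℂ, (∀ j, σ j ∈ ι.Uσ) →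
              ∀ i j, DifferentiableOn ℂ (fun φ => (𝔇 F θ k m).A Z t φ σ i j) (big F θ k (m + 1) Z)) ∧
            (∀ σ : TPt (F.P k).d (domCount (F.P k) θ.τ9.M (m + 1)) → ℂ, (∀ j, σ j ∈ ι.Uσ) →
              ∀ i j, DifferentiableOn ℂ (fun φ => ((𝔇 F θ k m).𝒦 Z t).G2 σ ((𝔇 F θ k m).uOf Z t φ) i j) (big F θ k (m + 1) Z)) ∧
            (∀ Y B, DifferentiableOn ℂ (fun φ => (𝔇 F θ k m).𝒱 Z t s old φ Y B) (big F θ k (m + 1) Z)) ∧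
            (∀ φ ∈ big F θ k (m + 1) Z, ∀ Y, Measurable ((𝔇 F θ k m).𝒱 Z t s old φ Y)) ∧
            (∀ φ ∈ big F θ k (m + 1) Z, ∀ σ : TPt (F.P k).d (domCount (F.P k) θ.τ9.M (m + 1)) → ℂ, (∀ j, σ j ∈ ι.Uσ) → ((𝔇 F θ k m).A Z t φ σ).IsSymm) ∧
            (∀ φ ∈ big F θ k (m + 1) Z, ∀ σ : TPt (F.P k).d (domCount (F.P k) θ.τ9.M (m + 1)) → ℂ, (∀ j, σ j ∈ ι.Uσ) →
              (((𝔇 F θ k m).A Z t φ σ).map Complex.re).PosDef) ∧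
            (∀ φ ∈ big F θ k (m + 1) Z, ∀ τ : TDom (F.P k).d ((L F θ k) * domCount (F.P k) θ.τ9.M (m + 1)) → ℂ, (∀ Y, τ Y ∈ ι.Uτ Y) →
              ∀ B, ∑ Y ∈ t.1, ‖τ Y‖ * ‖(𝔇 F θ k m).𝒱 Z t s old φ Y B‖ ≤ ι.a₂₀ / 2 * (B ⬝ᵥ B) + ι.w) ∧
            (∀ φ ∈ big F θ k (m + 1) Z, ∀ σ : TPt (F.P k).d (domCount (F.P k) θ.τ9.M (m + 1)) → ℂ, (∀ j, σ j ∈ ι.Uσ) →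
              ∀ b j, ‖((𝔇 F θ k m).𝒦 Z t).G2 σ ((𝔇 F θ k m).uOf Z t φ) b j‖ ≤
                ι.KG * Real.exp (-(ι.kap * tdist1 (𝔇 F θ k m).Nf (((𝔇 F θ k m).𝒦 Z t).locΛ b) (((𝔇 F θ k m).𝒦 Z t).locN j)))) ∧
            (∀ φ ∈ big F θ k (m + 1) Z, ∀ σ : TPt (F.P k).d (domCount (F.P k) θ.τ9.M (m + 1)) → ℂ, (∀ j, σ j ∈ ι.Uσ) →
              ∀ b b', ‖((𝔇 F θ k m).A Z t φ σ)⁻¹ b b'‖ ≤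
                ι.KCs * Real.exp (-(ι.kap * tdist1 (𝔇 F θ k m).Nf (((𝔇 F θ k m).𝒦 Z t).locΛ b) (((𝔇 F θ k m).𝒦 Z t).locΛ b')))) ∧
            (∀ φ ∈ big F θ k (m + 1) Z, ∀ σ : TPt (F.P k).d (domCount (F.P k) θ.τ9.M (m + 1)) → ℂ, (∀ j, σ j ∈ ι.Uσ) →
              ∀ b j, ‖(((𝔇 F θ k m).𝒦 Z t).G2 σ ((𝔇 F θ k m).uOf Z t φ) - ((𝔇 F θ k m).𝒦 Z t).Γ₀.map (algebraMap ℝ ℂ)) b j‖ ≤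
                ι.θΓ * Real.exp (-(ι.kap * tdist1 (𝔇 F θ k m).Nf (((𝔇 F θ k m).𝒦 Z t).locΛ b) (((𝔇 F θ k m).𝒦 Z t).locN j)))) ∧
            (∀ φ ∈ big F θ k (m + 1) Z, ∀ σ : TPt (F.P k).d (domCount (F.P k) θ.τ9.M (m + 1)) → ℂ, (∀ j, σ j ∈ ι.Uσ) →
              ∀ b b', ‖(((𝔇 F θ k m).A Z t φ σ)⁻¹ - ((𝔇 F θ k m).𝒦 Z t).C.map (algebraMap ℝ ℂ)) b b'‖ ≤
                ι.θC * Real.exp (-(ι.kap * tdist1 (𝔇 F θ k m).Nf (((𝔇 F θ k m).𝒦 Z t).locΛ b) (((𝔇 F θ k m).𝒦 Z t).locΛ b')))) ∧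
            (∀ φ ∈ big F θ k (m + 1) Z, ∀ σ : TPt (F.P k).d (domCount (F.P k) θ.τ9.M (m + 1)) → ℂ, (∀ j, σ j ∈ ι.Uσ) →
              ∀ b b', ‖((𝔇 F θ k m).A Z t φ σ - ((𝔇 F θ k m).𝒦 Z t).C⁻¹.map (algebraMap ℝ ℂ)) b b'‖ ≤
                ι.θE * Real.exp (-(ι.kap * tdist1 (𝔇 F θ k m).Nf (((𝔇 F θ k m).𝒦 Z t).locΛ b) (((𝔇 F θ k m).𝒦 Z t).locΛ b'))))) ∧
        0 ≤ (c F θ k).C3act * (c F θ k).ε₁ ∧ (c F θ k).C3act * (c F θ k).ε₁ ≤ A_A ∧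
        Rd ≤ (1 - 8 * (c F θ k).δ) * (((c F θ k).L : ℝ) / 2) * (c F θ k).κ ∧
        A_A * Real.exp (5 * κ + 1) * K₀ 64 8 * 9 * 64 < 1 ∧ Real.exp 1 * 9 * 64 * K₀ 64 8 ^ 2 * A_A ≤ E_A ∧
        (∀ m, SpRestr (sp F θ (k + 1) (m + 1))) ∧
        (∀ (m : ℕ) (Z : (domSys (F.P (k + 1)) θ.τ9.M (m + 1)).Dom), IsOpen (big F θ (k + 1) (m + 1) Z)) ∧
        (∀ (m : ℕ) (Z : (domSys (F.P (k + 1)) θ.τ9.M (m + 1)).Dom), sp F θ (k + 1) (m + 1) Z ⊆ big F θ (k + 1) (m + 1) Z) ∧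
        1 ≤ (c F θ (k + 1)).κ₁ ∧ (c F θ (k + 1)).α₆ ≠ 0 ∧ 8 ≤ (c F θ (k + 1)).L ∧ (c F θ (k + 1)).L = L F θ (k + 1) ∧
        Lemma3Numerics (c F θ (k + 1)) θ.τ9.M (((c F θ (k + 1)).L : ℝ) / 2) aB a₂B a₂B' a₅B AabsB ∧
        (∀ m : ℕ, ∀ s ∈ D F θ, ∀ old : OlderTerms (F.P (k + 1)) (MatA N) θ.τ9.M m,
          (∀ (j : Fin (m + 1)) (Y : (domSys (F.P (k + 1)) θ.τ9.M j).Dom), ∀ ψ ∈ sp F θ (k + 1) j Y, ‖old j Y ψ‖ ≤ E_B * Real.exp (-(κ * (domSys (F.P (k + 1)) θ.τ9.M j).dj Y))) →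
          (∀ (j : Fin (m + 1)) (Y : (domSys (F.P (k + 1)) θ.τ9.M j).Dom), AnalyticOnNhd ℂ (old j Y) (sp F θ (k + 1) j Y)) →
          ∀ (Z : (domSys (F.P (k + 1)) θ.τ9.M (m + 1)).Dom), ∀ t ∈ terms (L F θ (k + 1)) θ.τ9.M Z, ∀ φ₁ ∈ big F θ (k + 1) (m + 1) Z,
            ∃ ι : (𝔇 F θ (k + 1) m).Inputs226Holo (c F θ (k + 1)) Z t s old φ₁ aB a₅B,
            (∀ φ ∈ big F θ (k + 1) (m + 1) Z, ∀ i j, DifferentiableOn ℂ (fun σ => (𝔇 F θ (k + 1) m).A Z t φ σ i j) {σ | ∀ j, σ j ∈ ι.Uσ}) ∧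
            (∀ φ ∈ big F θ (k + 1) (m + 1) Z, ∀ i j, DifferentiableOn ℂ (fun σ => ((𝔇 F θ (k + 1) m).𝒦 Z t).G2 σ ((𝔇 F θ (k + 1) m).uOf Z t φ) i j) {σ | ∀ j, σ j ∈ ι.Uσ}) ∧
            (∀ σ : TPt (F.P (k + 1)).d (domCount (F.P (k + 1)) θ.τ9.M (m + 1)) → ℂ, (∀ j, σ j ∈ ι.Uσ) →
              ∀ i j, DifferentiableOn ℂ (fun φ => (𝔇 F θ (k + 1) m).A Z t φ σ i j) (big F θ (k + 1) (m + 1) Z)) ∧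
            (∀ σ : TPt (F.P (k + 1)).d (domCount (F.P (k + 1)) θ.τ9.M (m + 1)) → ℂ, (∀ j, σ j ∈ ι.Uσ) →
              ∀ i j, DifferentiableOn ℂ (fun φ => ((𝔇 F θ (k + 1) m).𝒦 Z t).G2 σ ((𝔇 F θ (k + 1) m).uOf Z t φ) i j) (big F θ (k + 1) (m + 1) Z)) ∧
            (∀ Y B, DifferentiableOn ℂ (fun φ => (𝔇 F θ (k + 1) m).𝒱 Z t s old φ Y B) (big F θ (k + 1) (m + 1) Z)) ∧
            (∀ φ ∈ big F θ (k + 1) (m + 1) Z, ∀ Y, Measurable ((𝔇 F θ (k + 1) m).𝒱 Z t s old φ Y)) ∧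
            (∀ φ ∈ big F θ (k + 1) (m + 1) Z, ∀ σ : TPt (F.P (k + 1)).d (domCount (F.P (k + 1)) θ.τ9.M (m + 1)) → ℂ, (∀ j, σ j ∈ ι.Uσ) → ((𝔇 F θ (k + 1) m).A Z t φ σ).IsSymm) ∧
            (∀ φ ∈ big F θ (k + 1) (m + 1) Z, ∀ σ : TPt (F.P (k + 1)).d (domCount (F.P (k + 1)) θ.τ9.M (m + 1)) → ℂ, (∀ j, σ j ∈ ι.Uσ) →
              (((𝔇 F θ (k + 1) m).A Z t φ σ).map Complex.re).PosDef) ∧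
            (∀ φ ∈ big F θ (k + 1) (m + 1) Z, ∀ τ : TDom (F.P (k + 1)).d ((L F θ (k + 1)) * domCount (F.P (k + 1)) θ.τ9.M (m + 1)) → ℂ, (∀ Y, τ Y ∈ ι.Uτ Y) →
              ∀ B, ∑ Y ∈ t.1, ‖τ Y‖ * ‖(𝔇 F θ (k + 1) m).𝒱 Z t s old φ Y B‖ ≤ ι.a₂₀ / 2 * (B ⬝ᵥ B) + ι.w) ∧
            (∀ φ ∈ big F θ (k + 1) (m + 1) Z, ∀ σ : TPt (F.P (k + 1)).d (domCount (F.P (k + 1)) θ.τ9.M (m + 1)) → ℂ, (∀ j, σ j ∈ ι.Uσ) →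
              ∀ b j, ‖((𝔇 F θ (k + 1) m).𝒦 Z t).G2 σ ((𝔇 F θ (k + 1) m).uOf Z t φ) b j‖ ≤
                ι.KG * Real.exp (-(ι.kap * tdist1 (𝔇 F θ (k + 1) m).Nf (((𝔇 F θ (k + 1) m).𝒦 Z t).locΛ b) (((𝔇 F θ (k + 1) m).𝒦 Z t).locN j)))) ∧
            (∀ φ ∈ big F θ (k + 1) (m + 1) Z, ∀ σ : TPt (F.P (k + 1)).d (domCount (F.P (k + 1)) θ.τ9.M (m + 1)) → ℂ, (∀ j, σ j ∈ ι.Uσ) →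
              ∀ b b', ‖((𝔇 F θ (k + 1) m).A Z t φ σ)⁻¹ b b'‖ ≤
                ι.KCs * Real.exp (-(ι.kap * tdist1 (𝔇 F θ (k + 1) m).Nf (((𝔇 F θ (k + 1) m).𝒦 Z t).locΛ b) (((𝔇 F θ (k + 1) m).𝒦 Z t).locΛ b')))) ∧
            (∀ φ ∈ big F θ (k + 1) (m + 1) Z, ∀ σ : TPt (F.P (k + 1)).d (domCount (F.P (k + 1)) θ.τ9.M (m + 1)) → ℂ, (∀ j, σ j ∈ ι.Uσ) →
              ∀ b j, ‖(((𝔇 F θ (k + 1) m).𝒦 Z t).G2 σ ((𝔇 F θ (k + 1) m).uOf Z t φ) - ((𝔇 F θ (k + 1) m).𝒦 Z t).Γ₀.map (algebraMap ℝ ℂ)) b j‖ ≤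
                ι.θΓ * Real.exp (-(ι.kap * tdist1 (𝔇 F θ (k + 1) m).Nf (((𝔇 F θ (k + 1) m).𝒦 Z t).locΛ b) (((𝔇 F θ (k + 1) m).𝒦 Z t).locN j)))) ∧
            (∀ φ ∈ big F θ (k + 1) (m + 1) Z, ∀ σ : TPt (F.P (k + 1)).d (domCount (F.P (k + 1)) θ.τ9.M (m + 1)) → ℂ, (∀ j, σ j ∈ ι.Uσ) →
              ∀ b b', ‖(((𝔇 F θ (k + 1) m).A Z t φ σ)⁻¹ - ((𝔇 F θ (k + 1) m).𝒦 Z t).C.map (algebraMap ℝ ℂ)) b b'‖ ≤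
                ι.θC * Real.exp (-(ι.kap * tdist1 (𝔇 F θ (k + 1) m).Nf (((𝔇 F θ (k + 1) m).𝒦 Z t).locΛ b) (((𝔇 F θ (k + 1) m).𝒦 Z t).locΛ b')))) ∧
            (∀ φ ∈ big F θ (k + 1) (m + 1) Z, ∀ σ : TPt (F.P (k + 1)).d (domCount (F.P (k + 1)) θ.τ9.M (m + 1)) → ℂ, (∀ j, σ j ∈ ι.Uσ) →
              ∀ b b', ‖((𝔇 F θ (k + 1) m).A Z t φ σ - ((𝔇 F θ (k + 1) m).𝒦 Z t).C⁻¹.map (algebraMap ℝ ℂ)) b b'‖ ≤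
                ι.θE * Real.exp (-(ι.kap * tdist1 (𝔇 F θ (k + 1) m).Nf (((𝔇 F θ (k + 1) m).𝒦 Z t).locΛ b) (((𝔇 F θ (k + 1) m).𝒦 Z t).locΛ b'))))) ∧
        0 ≤ (c F θ (k + 1)).C3act * (c F θ (k + 1)).ε₁ ∧ (c F θ (k + 1)).C3act * (c F θ (k + 1)).ε₁ ≤ A_B ∧
        Rd ≤ (1 - 8 * (c F θ (k + 1)).δ) * (((c F θ (k + 1)).L : ℝ) / 2) * (c F θ (k + 1)).κ ∧
        A_B * Real.exp (5 * κ + 1) * K₀ 64 8 * 9 * 64 < 1 ∧ Real.exp 1 * 9 * 64 * K₀ 64 8 ^ 2 * A_B ≤ E_B ∧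
        (∀ s ∈ Ioc (0 : ℝ) γ', ((s : ℝ) : ℂ) ∈ D F θ) ∧
        θ.γ ≤ γ' ∧ (li F θ).κ ≤ κ ∧ θ' ≤ (li F θ).θ₅ ∧
        (Real.exp 1 * 9 * 64 * K₀ 64 8 ^ 2 * (C3 * ε₁) / (1 - ρ₀) * (δ + δ') + B) * (θ' - ω) /
            (θ' - (ω + Real.exp 1 * 9 * 64 * K₀ 64 8 ^ 2 * (C3 * ε₁) / (1 - ρ₀) * cH)) ≤ (li F θ).C₅) :
    S_N18 (RRec₁₃CoP 𝔯) :=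
  s_N18_rRec₁₃CoP_of_forall_admissible_pin 𝔯 _ hpin fun F θ hP hA k => by
    haveI : NeZero θ.τ9.M := ⟨Nat.one_le_iff_ne_zero.mp hA.toStage9.2.2.2⟩
    exact n18At_u3OfRecord₁₃_readingAdm_runTowers_Gn₀_of_inputs226Holo θ k (c F θ) (L F θ) (𝔇 F θ) (D F θ) (sp F θ) (big F θ) (gauge F θ) (hg F θ)
      (T₀ F θ) (hT F θ) (li F θ) (h F θ hP hA k)

include hpin in
open Classical in
/-- ★ **THE TERM-DATA ROW AT THE REGIME-RESTRICTED `CoP` HOME — THE DATA ASKED ONLY OF THE TUPLES IN THE REGIME** [bookkeeping; p525011 under the guard, layer B's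
`s_N18_rRec₁₃CoPOn_iff`]: the same with (i), (ii)′ asked only at the admissible tuples with `Provisos₁₃Core` IN `Rg` ⟹ `S_N18 (RRec₁₃CoPOn 𝔯 Rg)` — rev 16 ∕ 17's
guarded binder at `Rg F θ := θ.ZtUnity F N ∧ θ.SlotsNondegenerate₁₃ F N`. [cite: Balaban1987RG1, (0.23)–(0.25) pp.256–257, Thm 1 p.259 and (1.18) p.263; Balaban1988RG2Cluster, (2.13)–(2.14) pp.14–15, (2.26) p.17 and Lemma 3 (2.38) p.20] -/
theorem s_N18_rRec₁₃CoPOn_readingAdm_runTowers_Gn₀_of_inputs226Holo_pin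
    (h : ∀ (F : T4Family) (θ : Stage13Params F N), θ.Provisos₁₃Core F N → Rg F θ → θ.Admissible F N → ∀ [NeZero θ.τ9.M] (k : ℕ),
      ∃ (Op : Type) (_ : NormedAddCommGroup Op) (_ : NormedSpace ℂ Op) (Hist : Type) (_ : NormedAddCommGroup Hist) (_ : NormedSpace ℂ Hist)
        (Mb : ℝ → StepModel (LevelPairing.ofRecordAdm F θ.τ9.M N k (sp F θ) (gauge F θ k) (hg F θ k) (T₀ F θ k) (hT F θ k)).carriers Op Hist)
        (act : ℝ → (j : ℕ) → Op × Hist → TDom 4 (domCount (F.P k) θ.τ9.M j) → ℂ) (γ' C3 ε₁ Rd κ A_A A_B E_A E_B E₁ δ δ' θr θ' cH ω ρ₀ B : ℝ) (k₀ : ℕ)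
        (aA a₂A a₂A' a₅A AabsA aB a₂B a₂B' a₅B AabsB : ℝ),
        (∀ b : ℝ, 0 < b → b ≤ γ' → ∀ (X : Node00.W1.Dom (F.P k) θ.τ9.M) (z : Op × Hist),
          (Mb b).Out X.1 z.1 z.2 X =
            locE (TTouch (d := 4) (N := domCount (F.P k) θ.τ9.M X.1)) (fun Z : (tsys 4 (domCount (F.P k) θ.τ9.M X.1)).Dom => Z.1)
              (act b X.1 z) X.2.1) ∧
        0 ≤ C3 ∧ 0 ≤ ε₁ ∧ 0 ≤ κ ∧ κ + 2 * (64 * Real.log 162) + 2 ≤ Rd ∧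
        C3 * ε₁ * Real.exp (5 * κ + 1) * K₀ 64 8 * 9 * 64 ≤ 1 ∧
        (∀ b : ℝ, 0 < b → b ≤ γ' → ∀ j, ∀ g ∈ Window γ',
          ∀ (U : (LevelPairing.ofRecordAdm F θ.τ9.M N k (sp F θ) (gauge F θ k) (hg F θ k) (T₀ F θ k) (hT F θ k)).BgB) (q : Op × Hist), q ∈ (Mb b).Base j g U →
          ∃ V : Set (Op × Hist), IsOpen V ∧ (Mb b).box j q ⊆ V ∧
            (∀ Z : TDom 4 (domCount (F.P k) θ.τ9.M j), DifferentiableOn ℂ (fun z : Op × Hist => act b j z Z) V) ∧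
            (∀ z ∈ V, ∀ Z : TDom 4 (domCount (F.P k) θ.τ9.M j), ‖act b j z Z‖ ≤ C3 * ε₁ * Real.exp (-(Rd * torusTreeLen Z.1)))) ∧
        (∀ b : ℝ, 0 < b → b ≤ γ' → L01 (Mb b)
          ((LevelPairing.ofRecordAdm F θ.τ9.M N k (sp F θ) (gauge F θ k) (hg F θ k) (T₀ F θ k) (hT F θ k)).EA (runTowers (fun k => toClusterTower ((𝔇 F θ k).Gn₀)) k)) (Window γ')) ∧
        (∀ b : ℝ, 0 < b → b ≤ γ' → L02 (Mb b)
          ((LevelPairing.ofRecordAdm F θ.τ9.M N k (sp F θ) (gauge F θ k) (hg F θ k) (T₀ F θ k) (hT F θ k)).EB (runTowers (fun k => toClusterTower ((𝔇 F θ k).Gn₀)) (k + 1)) b) (Window γ')) ∧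
        (∀ b : ℝ, 0 < b → b ≤ γ' → L03 (Mb b)
          ((LevelPairing.ofRecordAdm F θ.τ9.M N k (sp F θ) (gauge F θ k) (hg F θ k) (T₀ F θ k) (hT F θ k)).EB (runTowers (fun k => toClusterTower ((𝔇 F θ k).Gn₀)) (k + 1)) b) (Window γ')) ∧
        (∀ b : ℝ, 0 < b → b ≤ γ' → L07 (Mb b) (Window γ') δ θr) ∧
        (∀ b : ℝ, 0 < b → b ≤ γ' → L08 (Mb b) (Window γ') κ (Real.exp 1 * 9 * 64 * K₀ 64 8 ^ 2 * A_B) δ' θr) ∧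
        (∀ b : ℝ, 0 < b → b ≤ γ' → L09aff (Mb b) (Window γ')) ∧ (∀ b : ℝ, 0 < b → b ≤ γ' → L09blind (Mb b) (Window γ')) ∧
        (∀ b : ℝ, 0 < b → b ≤ γ' → L09hom (Mb b) (Window γ')) ∧ (∀ b : ℝ, 0 < b → b ≤ γ' → L09unit (Mb b) (Window γ') κ E₁ cH ω) ∧
        0 < E₁ ∧ 0 ≤ δ + δ' ∧ 0 ≤ θr ∧ θr ≤ θ' ∧ θ' ≤ 1 ∧ 0 ≤ cH ∧ 0 < ω ∧ ρ₀ < 1 ∧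
        (δ + δ') * θr ^ k₀ +
            cH * (Real.exp 1 * 9 * 64 * K₀ 64 8 ^ 2 * A_A + Real.exp 1 * 9 * 64 * K₀ 64 8 ^ 2 * A_B) / (1 - ω) ≤ ρ₀ ∧
        0 ≤ B ∧ (∀ k < k₀, Real.exp 1 * 9 * 64 * K₀ 64 8 ^ 2 * A_A + Real.exp 1 * 9 * 64 * K₀ 64 8 ^ 2 * A_B ≤ B * θr ^ k) ∧
        Real.exp 1 * 9 * 64 * K₀ 64 8 ^ 2 * C3 * cH * ε₁ < (θ' - ω) * (1 - ρ₀) ∧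
        (∀ m, SpRestr (sp F θ k (m + 1))) ∧
        (∀ (m : ℕ) (Z : (domSys (F.P k) θ.τ9.M (m + 1)).Dom), IsOpen (big F θ k (m + 1) Z)) ∧
        (∀ (m : ℕ) (Z : (domSys (F.P k) θ.τ9.M (m + 1)).Dom), sp F θ k (m + 1) Z ⊆ big F θ k (m + 1) Z) ∧
        1 ≤ (c F θ k).κ₁ ∧ (c F θ k).α₆ ≠ 0 ∧ 8 ≤ (c F θ k).L ∧ (c F θ k).L = L F θ k ∧
        Lemma3Numerics (c F θ k) θ.τ9.M (((c F θ k).L : ℝ) / 2) aA a₂A a₂A' a₅A AabsA ∧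
        (∀ m : ℕ, ∀ s ∈ D F θ, ∀ old : OlderTerms (F.P k) (MatA N) θ.τ9.M m,
          (∀ (j : Fin (m + 1)) (Y : (domSys (F.P k) θ.τ9.M j).Dom), ∀ ψ ∈ sp F θ k j Y, ‖old j Y ψ‖ ≤ E_A * Real.exp (-(κ * (domSys (F.P k) θ.τ9.M j).dj Y))) →
          (∀ (j : Fin (m + 1)) (Y : (domSys (F.P k) θ.τ9.M j).Dom), AnalyticOnNhd ℂ (old j Y) (sp F θ k j Y)) →
          ∀ (Z : (domSys (F.P k) θ.τ9.M (m + 1)).Dom), ∀ t ∈ terms (L F θ k) θ.τ9.M Z, ∀ φ₁ ∈ big F θ k (m + 1) Z,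
            ∃ ι : (𝔇 F θ k m).Inputs226Holo (c F θ k) Z t s old φ₁ aA a₅A,
            (∀ φ ∈ big F θ k (m + 1) Z, ∀ i j, DifferentiableOn ℂ (fun σ => (𝔇 F θ k m).A Z t φ σ i j) {σ | ∀ j, σ j ∈ ι.Uσ}) ∧
            (∀ φ ∈ big F θ k (m + 1) Z, ∀ i j, DifferentiableOn ℂ (fun σ => ((𝔇 F θ k m).𝒦 Z t).G2 σ ((𝔇 F θ k m).uOf Z t φ) i j) {σ | ∀ j, σ j ∈ ι.Uσ}) ∧
            (∀ σ : TPt (F.P k).d (domCount (F.P k) θ.τ9.M (m + 1)) → ℂ, (∀ j, σ j ∈ ι.Uσ) →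
              ∀ i j, DifferentiableOn ℂ (fun φ => (𝔇 F θ k m).A Z t φ σ i j) (big F θ k (m + 1) Z)) ∧
            (∀ σ : TPt (F.P k).d (domCount (F.P k) θ.τ9.M (m + 1)) → ℂ, (∀ j, σ j ∈ ι.Uσ) →
              ∀ i j, DifferentiableOn ℂ (fun φ => ((𝔇 F θ k m).𝒦 Z t).G2 σ ((𝔇 F θ k m).uOf Z t φ) i j) (big F θ k (m + 1) Z)) ∧
            (∀ Y B, DifferentiableOn ℂ (fun φ => (𝔇 F θ k m).𝒱 Z t s old φ Y B) (big F θ k (m + 1) Z)) ∧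
            (∀ φ ∈ big F θ k (m + 1) Z, ∀ Y, Measurable ((𝔇 F θ k m).𝒱 Z t s old φ Y)) ∧
            (∀ φ ∈ big F θ k (m + 1) Z, ∀ σ : TPt (F.P k).d (domCount (F.P k) θ.τ9.M (m + 1)) → ℂ, (∀ j, σ j ∈ ι.Uσ) → ((𝔇 F θ k m).A Z t φ σ).IsSymm) ∧
            (∀ φ ∈ big F θ k (m + 1) Z, ∀ σ : TPt (F.P k).d (domCount (F.P k) θ.τ9.M (m + 1)) → ℂ, (∀ j, σ j ∈ ι.Uσ) →
              (((𝔇 F θ k m).A Z t φ σ).map Complex.re).PosDef) ∧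
            (∀ φ ∈ big F θ k (m + 1) Z, ∀ τ : TDom (F.P k).d ((L F θ k) * domCount (F.P k) θ.τ9.M (m + 1)) → ℂ, (∀ Y, τ Y ∈ ι.Uτ Y) →
              ∀ B, ∑ Y ∈ t.1, ‖τ Y‖ * ‖(𝔇 F θ k m).𝒱 Z t s old φ Y B‖ ≤ ι.a₂₀ / 2 * (B ⬝ᵥ B) + ι.w) ∧
            (∀ φ ∈ big F θ k (m + 1) Z, ∀ σ : TPt (F.P k).d (domCount (F.P k) θ.τ9.M (m + 1)) → ℂ, (∀ j, σ j ∈ ι.Uσ) →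
              ∀ b j, ‖((𝔇 F θ k m).𝒦 Z t).G2 σ ((𝔇 F θ k m).uOf Z t φ) b j‖ ≤
                ι.KG * Real.exp (-(ι.kap * tdist1 (𝔇 F θ k m).Nf (((𝔇 F θ k m).𝒦 Z t).locΛ b) (((𝔇 F θ k m).𝒦 Z t).locN j)))) ∧
            (∀ φ ∈ big F θ k (m + 1) Z, ∀ σ : TPt (F.P k).d (domCount (F.P k) θ.τ9.M (m + 1)) → ℂ, (∀ j, σ j ∈ ι.Uσ) →
              ∀ b b', ‖((𝔇 F θ k m).A Z t φ σ)⁻¹ b b'‖ ≤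
                ι.KCs * Real.exp (-(ι.kap * tdist1 (𝔇 F θ k m).Nf (((𝔇 F θ k m).𝒦 Z t).locΛ b) (((𝔇 F θ k m).𝒦 Z t).locΛ b')))) ∧
            (∀ φ ∈ big F θ k (m + 1) Z, ∀ σ : TPt (F.P k).d (domCount (F.P k) θ.τ9.M (m + 1)) → ℂ, (∀ j, σ j ∈ ι.Uσ) →
              ∀ b j, ‖(((𝔇 F θ k m).𝒦 Z t).G2 σ ((𝔇 F θ k m).uOf Z t φ) - ((𝔇 F θ k m).𝒦 Z t).Γ₀.map (algebraMap ℝ ℂ)) b j‖ ≤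
                ι.θΓ * Real.exp (-(ι.kap * tdist1 (𝔇 F θ k m).Nf (((𝔇 F θ k m).𝒦 Z t).locΛ b) (((𝔇 F θ k m).𝒦 Z t).locN j)))) ∧
            (∀ φ ∈ big F θ k (m + 1) Z, ∀ σ : TPt (F.P k).d (domCount (F.P k) θ.τ9.M (m + 1)) → ℂ, (∀ j, σ j ∈ ι.Uσ) →
              ∀ b b', ‖(((𝔇 F θ k m).A Z t φ σ)⁻¹ - ((𝔇 F θ k m).𝒦 Z t).C.map (algebraMap ℝ ℂ)) b b'‖ ≤
                ι.θC * Real.exp (-(ι.kap * tdist1 (𝔇 F θ k m).Nf (((𝔇 F θ k m).𝒦 Z t).locΛ b) (((𝔇 F θ k m).𝒦 Z t).locΛ b')))) ∧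
            (∀ φ ∈ big F θ k (m + 1) Z, ∀ σ : TPt (F.P k).d (domCount (F.P k) θ.τ9.M (m + 1)) → ℂ, (∀ j, σ j ∈ ι.Uσ) →
              ∀ b b', ‖((𝔇 F θ k m).A Z t φ σ - ((𝔇 F θ k m).𝒦 Z t).C⁻¹.map (algebraMap ℝ ℂ)) b b'‖ ≤
                ι.θE * Real.exp (-(ι.kap * tdist1 (𝔇 F θ k m).Nf (((𝔇 F θ k m).𝒦 Z t).locΛ b) (((𝔇 F θ k m).𝒦 Z t).locΛ b'))))) ∧
        0 ≤ (c F θ k).C3act * (c F θ k).ε₁ ∧ (c F θ k).C3act * (c F θ k).ε₁ ≤ A_A ∧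
        Rd ≤ (1 - 8 * (c F θ k).δ) * (((c F θ k).L : ℝ) / 2) * (c F θ k).κ ∧
        A_A * Real.exp (5 * κ + 1) * K₀ 64 8 * 9 * 64 < 1 ∧ Real.exp 1 * 9 * 64 * K₀ 64 8 ^ 2 * A_A ≤ E_A ∧
        (∀ m, SpRestr (sp F θ (k + 1) (m + 1))) ∧
        (∀ (m : ℕ) (Z : (domSys (F.P (k + 1)) θ.τ9.M (m + 1)).Dom), IsOpen (big F θ (k + 1) (m + 1) Z)) ∧
        (∀ (m : ℕ) (Z : (domSys (F.P (k + 1)) θ.τ9.M (m + 1)).Dom), sp F θ (k + 1) (m + 1) Z ⊆ big F θ (k + 1) (m + 1) Z) ∧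
        1 ≤ (c F θ (k + 1)).κ₁ ∧ (c F θ (k + 1)).α₆ ≠ 0 ∧ 8 ≤ (c F θ (k + 1)).L ∧ (c F θ (k + 1)).L = L F θ (k + 1) ∧
        Lemma3Numerics (c F θ (k + 1)) θ.τ9.M (((c F θ (k + 1)).L : ℝ) / 2) aB a₂B a₂B' a₅B AabsB ∧
        (∀ m : ℕ, ∀ s ∈ D F θ, ∀ old : OlderTerms (F.P (k + 1)) (MatA N) θ.τ9.M m,
          (∀ (j : Fin (m + 1)) (Y : (domSys (F.P (k + 1)) θ.τ9.M j).Dom), ∀ ψ ∈ sp F θ (k + 1) j Y, ‖old j Y ψ‖ ≤ E_B * Real.exp (-(κ * (domSys (F.P (k + 1)) θ.τ9.M j).dj Y))) →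
          (∀ (j : Fin (m + 1)) (Y : (domSys (F.P (k + 1)) θ.τ9.M j).Dom), AnalyticOnNhd ℂ (old j Y) (sp F θ (k + 1) j Y)) →
          ∀ (Z : (domSys (F.P (k + 1)) θ.τ9.M (m + 1)).Dom), ∀ t ∈ terms (L F θ (k + 1)) θ.τ9.M Z, ∀ φ₁ ∈ big F θ (k + 1) (m + 1) Z,
            ∃ ι : (𝔇 F θ (k + 1) m).Inputs226Holo (c F θ (k + 1)) Z t s old φ₁ aB a₅B,
            (∀ φ ∈ big F θ (k + 1) (m + 1) Z, ∀ i j, DifferentiableOn ℂ (fun σ => (𝔇 F θ (k + 1) m).A Z t φ σ i j) {σ | ∀ j, σ j ∈ ι.Uσ}) ∧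
            (∀ φ ∈ big F θ (k + 1) (m + 1) Z, ∀ i j, DifferentiableOn ℂ (fun σ => ((𝔇 F θ (k + 1) m).𝒦 Z t).G2 σ ((𝔇 F θ (k + 1) m).uOf Z t φ) i j) {σ | ∀ j, σ j ∈ ι.Uσ}) ∧
            (∀ σ : TPt (F.P (k + 1)).d (domCount (F.P (k + 1)) θ.τ9.M (m + 1)) → ℂ, (∀ j, σ j ∈ ι.Uσ) →
              ∀ i j, DifferentiableOn ℂ (fun φ => (𝔇 F θ (k + 1) m).A Z t φ σ i j) (big F θ (k + 1) (m + 1) Z)) ∧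
            (∀ σ : TPt (F.P (k + 1)).d (domCount (F.P (k + 1)) θ.τ9.M (m + 1)) → ℂ, (∀ j, σ j ∈ ι.Uσ) →
              ∀ i j, DifferentiableOn ℂ (fun φ => ((𝔇 F θ (k + 1) m).𝒦 Z t).G2 σ ((𝔇 F θ (k + 1) m).uOf Z t φ) i j) (big F θ (k + 1) (m + 1) Z)) ∧
            (∀ Y B, DifferentiableOn ℂ (fun φ => (𝔇 F θ (k + 1) m).𝒱 Z t s old φ Y B) (big F θ (k + 1) (m + 1) Z)) ∧
            (∀ φ ∈ big F θ (k + 1) (m + 1) Z, ∀ Y, Measurable ((𝔇 F θ (k + 1) m).𝒱 Z t s old φ Y)) ∧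
            (∀ φ ∈ big F θ (k + 1) (m + 1) Z, ∀ σ : TPt (F.P (k + 1)).d (domCount (F.P (k + 1)) θ.τ9.M (m + 1)) → ℂ, (∀ j, σ j ∈ ι.Uσ) → ((𝔇 F θ (k + 1) m).A Z t φ σ).IsSymm) ∧
            (∀ φ ∈ big F θ (k + 1) (m + 1) Z, ∀ σ : TPt (F.P (k + 1)).d (domCount (F.P (k + 1)) θ.τ9.M (m + 1)) → ℂ, (∀ j, σ j ∈ ι.Uσ) →
              (((𝔇 F θ (k + 1) m).A Z t φ σ).map Complex.re).PosDef) ∧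
            (∀ φ ∈ big F θ (k + 1) (m + 1) Z, ∀ τ : TDom (F.P (k + 1)).d ((L F θ (k + 1)) * domCount (F.P (k + 1)) θ.τ9.M (m + 1)) → ℂ, (∀ Y, τ Y ∈ ι.Uτ Y) →
              ∀ B, ∑ Y ∈ t.1, ‖τ Y‖ * ‖(𝔇 F θ (k + 1) m).𝒱 Z t s old φ Y B‖ ≤ ι.a₂₀ / 2 * (B ⬝ᵥ B) + ι.w) ∧
            (∀ φ ∈ big F θ (k + 1) (m + 1) Z, ∀ σ : TPt (F.P (k + 1)).d (domCount (F.P (k + 1)) θ.τ9.M (m + 1)) → ℂ, (∀ j, σ j ∈ ι.Uσ) →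
              ∀ b j, ‖((𝔇 F θ (k + 1) m).𝒦 Z t).G2 σ ((𝔇 F θ (k + 1) m).uOf Z t φ) b j‖ ≤
                ι.KG * Real.exp (-(ι.kap * tdist1 (𝔇 F θ (k + 1) m).Nf (((𝔇 F θ (k + 1) m).𝒦 Z t).locΛ b) (((𝔇 F θ (k + 1) m).𝒦 Z t).locN j)))) ∧
            (∀ φ ∈ big F θ (k + 1) (m + 1) Z, ∀ σ : TPt (F.P (k + 1)).d (domCount (F.P (k + 1)) θ.τ9.M (m + 1)) → ℂ, (∀ j, σ j ∈ ι.Uσ) →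
              ∀ b b', ‖((𝔇 F θ (k + 1) m).A Z t φ σ)⁻¹ b b'‖ ≤
                ι.KCs * Real.exp (-(ι.kap * tdist1 (𝔇 F θ (k + 1) m).Nf (((𝔇 F θ (k + 1) m).𝒦 Z t).locΛ b) (((𝔇 F θ (k + 1) m).𝒦 Z t).locΛ b')))) ∧
            (∀ φ ∈ big F θ (k + 1) (m + 1) Z, ∀ σ : TPt (F.P (k + 1)).d (domCount (F.P (k + 1)) θ.τ9.M (m + 1)) → ℂ, (∀ j, σ j ∈ ι.Uσ) →
              ∀ b j, ‖(((𝔇 F θ (k + 1) m).𝒦 Z t).G2 σ ((𝔇 F θ (k + 1) m).uOf Z t φ) - ((𝔇 F θ (k + 1) m).𝒦 Z t).Γ₀.map (algebraMap ℝ ℂ)) b j‖ ≤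
                ι.θΓ * Real.exp (-(ι.kap * tdist1 (𝔇 F θ (k + 1) m).Nf (((𝔇 F θ (k + 1) m).𝒦 Z t).locΛ b) (((𝔇 F θ (k + 1) m).𝒦 Z t).locN j)))) ∧
            (∀ φ ∈ big F θ (k + 1) (m + 1) Z, ∀ σ : TPt (F.P (k + 1)).d (domCount (F.P (k + 1)) θ.τ9.M (m + 1)) → ℂ, (∀ j, σ j ∈ ι.Uσ) →
              ∀ b b', ‖(((𝔇 F θ (k + 1) m).A Z t φ σ)⁻¹ - ((𝔇 F θ (k + 1) m).𝒦 Z t).C.map (algebraMap ℝ ℂ)) b b'‖ ≤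
                ι.θC * Real.exp (-(ι.kap * tdist1 (𝔇 F θ (k + 1) m).Nf (((𝔇 F θ (k + 1) m).𝒦 Z t).locΛ b) (((𝔇 F θ (k + 1) m).𝒦 Z t).locΛ b')))) ∧
            (∀ φ ∈ big F θ (k + 1) (m + 1) Z, ∀ σ : TPt (F.P (k + 1)).d (domCount (F.P (k + 1)) θ.τ9.M (m + 1)) → ℂ, (∀ j, σ j ∈ ι.Uσ) →
              ∀ b b', ‖((𝔇 F θ (k + 1) m).A Z t φ σ - ((𝔇 F θ (k + 1) m).𝒦 Z t).C⁻¹.map (algebraMap ℝ ℂ)) b b'‖ ≤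
                ι.θE * Real.exp (-(ι.kap * tdist1 (𝔇 F θ (k + 1) m).Nf (((𝔇 F θ (k + 1) m).𝒦 Z t).locΛ b) (((𝔇 F θ (k + 1) m).𝒦 Z t).locΛ b'))))) ∧
        0 ≤ (c F θ (k + 1)).C3act * (c F θ (k + 1)).ε₁ ∧ (c F θ (k + 1)).C3act * (c F θ (k + 1)).ε₁ ≤ A_B ∧
        Rd ≤ (1 - 8 * (c F θ (k + 1)).δ) * (((c F θ (k + 1)).L : ℝ) / 2) * (c F θ (k + 1)).κ ∧
        A_B * Real.exp (5 * κ + 1) * K₀ 64 8 * 9 * 64 < 1 ∧ Real.exp 1 * 9 * 64 * K₀ 64 8 ^ 2 * A_B ≤ E_B ∧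
        (∀ s ∈ Ioc (0 : ℝ) γ', ((s : ℝ) : ℂ) ∈ D F θ) ∧
        θ.γ ≤ γ' ∧ (li F θ).κ ≤ κ ∧ θ' ≤ (li F θ).θ₅ ∧
        (Real.exp 1 * 9 * 64 * K₀ 64 8 ^ 2 * (C3 * ε₁) / (1 - ρ₀) * (δ + δ') + B) * (θ' - ω) /
            (θ' - (ω + Real.exp 1 * 9 * 64 * K₀ 64 8 ^ 2 * (C3 * ε₁) / (1 - ρ₀) * cH)) ≤ (li F θ).C₅) :
    S_N18 (RRec₁₃CoPOn 𝔯 Rg) := by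
  rw [s_N18_rRec₁₃CoPOn_iff]
  intro F θ hP hRg hA g₀ os k
  rw [hpin]
  haveI : NeZero θ.τ9.M := ⟨Nat.one_le_iff_ne_zero.mp hA.toStage9.2.2.2⟩
  exact n18At_u3OfRecord₁₃_readingAdm_runTowers_Gn₀_of_inputs226Holo θ k (c F θ) (L F θ) (𝔇 F θ) (D F θ) (sp F θ) (big F θ) (gauge F θ) (hg F θ)
    (T₀ F θ) (hT F θ) (li F θ) (h F θ hP hRg hA k)

end Record

end YMDAG.N18.W1Reading

end
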